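import Literature.Geometry.DiscreteGeometry.ThreePointBoundGeneral

/-!
# Equality case of the Bachoc–Vallentin three-point bound: what an extremal code must look like

Framing: lottery ticket; floor = certified bounds/negative ranges. Venture `PackingBounds`
(cell `pub-packcert`), three-point SDP family. Our own (new) lemma, on top of the formalised
Bachoc–Vallentin chain `BachocVallentin.card_le_of_threePoint` (tree).

**Lemma (equality case, `B = 0`).** Let `C ⊂ S^{n-1}` be a finite code with pairwise inner products
`≤ s`, and let `A`, `F` be as in Theorem 4.2 with `B = 0`: `Σ_{x,y} A(x·y) ≥ 0`, `Σ_{x,y,z} F ≥ 0`,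
`F` symmetric, (i) `A(u) + 3F(u,u,1) ≤ -1` on `[-1, s]`, (ii) `F ≤ 0` on the domain `D'`. If the bound
is ATTAINED, `|C| = 1 + A(1) + F(1,1,1)`, then every dropped nonnegative quantity vanishes; in
particular `Σ_{x,y ∈ C} A(x·y) = 0` and the pair constraint (i) is TIGHT at every pair of distinct
code points: `A(x·y) + 3F(x·y, x·y, 1) = -1`. (With `A = Σ_k a_k P_k`, `a_k ≥ 0`, the first gives
`Σ_{x,y} P_k(x·y) = 0` for every `k` with `a_k > 0` — design-type moment conditions — and the second
confines all inner products to the real zero set of the (i)-slack polynomial; this is the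
complementary-slackness mechanism of Dostert–de Laat–Moustrou 2021 / Cohn–de Laat–Leijenhorst 2024,
used by the cell for the structure of the `A(9, arccos 1/3)` optimum.)

## References
* C. Bachoc, F. Vallentin, J. Amer. Math. Soc. 21 (2008) 909–924, Theorem 4.2. [`BachocVallentin2007`]
* M. Dostert, D. de Laat, P. Moustrou, SIAM J. Optim. 31 (2021) 1433–1458, §4 (complementary slackness). [`DostertDeLaatMoustrou2021`]
-/

noncomputable section

open Finset
open scoped RealInnerProductSpace

namespace Summit.Ventures.PackingBounds.SphericalCodes

open Literature.Geometry.DiscreteGeometry.BachocVallentin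

variable {n : ℕ}

/-- In a sum of nonpositive terms that vanishes, every term vanishes (double-sum form over a code
and its punctured copies). -/
private theorem double_sum_eq_zero_terms (C : Finset (EuclideanSpace ℝ (Fin n)))
    (g : EuclideanSpace ℝ (Fin n) → EuclideanSpace ℝ (Fin n) → ℝ)
    (hle : ∀ x ∈ C, ∀ y ∈ C.erase x, g x y ≤ 0)
    (hsum : ∑ x ∈ C, ∑ y ∈ C.erase x, g x y = 0) :
    ∀ x ∈ C, ∀ y ∈ C.erase x, g x y = 0 := by
  have hin : ∀ x ∈ C, ∑ y ∈ C.erase x, g x y ≤ 0 := fun x hx =>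
    Finset.sum_nonpos fun y hy => hle x hx y hy
  have h0 := (Finset.sum_eq_zero_iff_of_nonpos hin).1 hsum
  intro x hx y hy
  exact (Finset.sum_eq_zero_iff_of_nonpos (hle x hx)).1 (h0 x hx) y hy

/-- **Equality case of the three-point bound (`B = 0`).** Under the hypotheses of
`BachocVallentin.card_le_of_threePoint` with `b₁₁ = b₁₂ = b₂₂ = 0`, if `|C| = 1 + A(1) + F(1,1,1)`
then `Σ_{x,y∈C} A(x·y) = 0`, `Σ_{x,y,z∈C} F = 0`, and the pair constraint is tight at every pair of
distinct code points: `A(x·y) + 3 F(x·y, x·y, 1) = -1`. -/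
theorem threePoint_tight_of_card_eq (s : ℝ) (C : Finset (EuclideanSpace ℝ (Fin n)))
    (hC : ∀ x ∈ C, ‖x‖ = 1) (hcode : ∀ x ∈ C, ∀ y ∈ C, x ≠ y → inner ℝ x y ≤ s)
    (A : ℝ → ℝ) (F : ℝ → ℝ → ℝ → ℝ)
    (hA : 0 ≤ pairSum C A) (hF : 0 ≤ tripleSum C F)
    (hF12 : ∀ u v t, F u v t = F v u t) (hF23 : ∀ u v t, F u v t = F u t v)
    (h1 : ∀ u : ℝ, -1 ≤ u → u ≤ s → A u + 3 * F u u 1 ≤ -1)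
    (h2 : ∀ u v t : ℝ, -1 ≤ u → u ≤ s → -1 ≤ v → v ≤ s → -1 ≤ t → t ≤ s →
      0 ≤ 1 + 2 * u * v * t - u ^ 2 - v ^ 2 - t ^ 2 → F u v t ≤ 0)
    (heq : (C.card : ℝ) = 1 + A 1 + F 1 1 1) :
    pairSum C A = 0 ∧ tripleSum C F = 0 ∧
      ∀ x ∈ C, ∀ y ∈ C, x ≠ y → A (inner ℝ x y) + 3 * F (inner ℝ x y) (inner ℝ x y) 1 = -1 := by
  classical
  set M : ℝ := (C.card : ℝ) with hM
  have hself : ∀ x ∈ C, inner ℝ x x = (1 : ℝ) := fun x hx => by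
    rw [real_inner_self_eq_norm_sq, hC x hx]; norm_num
  have hrange : ∀ x ∈ C, ∀ y ∈ C, x ≠ y → -1 ≤ inner ℝ x y ∧ inner ℝ x y ≤ s := by
    intro x hx y hy hxy
    refine ⟨?_, hcode x hx y hy hxy⟩
    have h := abs_real_inner_le_norm x y
    rw [hC x hx, hC y hy, mul_one] at h
    exact (abs_le.1 h).1
  have hcard1 : ∀ x ∈ C, ((C.erase x).card : ℝ) = M - 1 := by
    intro x hx
    rw [Finset.card_erase_of_mem hx, Nat.cast_sub (Finset.card_pos.2 ⟨x, hx⟩), hM]; simp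
  -- Step a: split the pair sum
  have hpair : pairSum C A = M * A 1 + ∑ x ∈ C, ∑ y ∈ C.erase x, A (inner ℝ x y) := by
    unfold pairSum
    rw [show M * A 1 = ∑ x ∈ C, A 1 by rw [Finset.sum_const, nsmul_eq_mul, hM],
      ← Finset.sum_add_distrib]
    refine Finset.sum_congr rfl fun x hx => ?_
    rw [← Finset.add_sum_erase C _ hx, hself x hx]
  -- Step a': split the triple sum
  have htriple : tripleSum C F = M * F 1 1 1
      + 3 * ∑ x ∈ C, ∑ y ∈ C.erase x, F (inner ℝ x y) (inner ℝ x y) 1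
      + ∑ x ∈ C, ∑ y ∈ C.erase x, ∑ z ∈ (C.erase x).erase y,
          F (inner ℝ x y) (inner ℝ x z) (inner ℝ y z) := by
    unfold tripleSum
    have hx_split : ∀ x ∈ C,
        (∑ y ∈ C, ∑ z ∈ C, F (inner ℝ x y) (inner ℝ x z) (inner ℝ y z)) =
          F 1 1 1 + 3 * ∑ y ∈ C.erase x, F (inner ℝ x y) (inner ℝ x y) 1 +
            ∑ y ∈ C.erase x, ∑ z ∈ (C.erase x).erase y,
              F (inner ℝ x y) (inner ℝ x z) (inner ℝ y z) := by
      intro x hx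
      rw [← Finset.add_sum_erase C _ hx]
      have hyx : (∑ z ∈ C, F (inner ℝ x x) (inner ℝ x z) (inner ℝ x z)) =
          F 1 1 1 + ∑ z ∈ C.erase x, F (inner ℝ x z) (inner ℝ x z) 1 := by
        rw [← Finset.add_sum_erase C _ hx, hself x hx]
        congr 1
        refine Finset.sum_congr rfl fun z _ => ?_
        rw [hF12, hF23]
      have hyne : ∀ y ∈ C.erase x,
          (∑ z ∈ C, F (inner ℝ x y) (inner ℝ x z) (inner ℝ y z)) =
            2 * F (inner ℝ x y) (inner ℝ x y) 1 +
              ∑ z ∈ (C.erase x).erase y, F (inner ℝ x y) (inner ℝ x z) (inner ℝ y z) := by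
        intro y hy
        have hyC : y ∈ C := Finset.mem_of_mem_erase hy
        rw [← Finset.add_sum_erase C _ hx, ← Finset.add_sum_erase (C.erase x) _ hy, hself x hx,
          hself y hyC, real_inner_comm x y]
        have e1 : F (inner ℝ x y) 1 (inner ℝ x y) = F (inner ℝ x y) (inner ℝ x y) 1 := by
          rw [hF23]
        rw [e1]; ring
      rw [hyx, Finset.sum_congr rfl hyne, Finset.sum_add_distrib, ← Finset.mul_sum]
      ring
    rw [Finset.sum_congr rfl hx_split, Finset.sum_add_distrib, Finset.sum_add_distrib,
      Finset.sum_const, nsmul_eq_mul, ← hM, ← Finset.mul_sum]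
  -- the pair terms g(x,y) := A + 3F + 1 ≤ 0, the triple terms ≤ 0
  set g : EuclideanSpace ℝ (Fin n) → EuclideanSpace ℝ (Fin n) → ℝ :=
    fun x y => A (inner ℝ x y) + 3 * F (inner ℝ x y) (inner ℝ x y) 1 + 1 with hg
  have hgle : ∀ x ∈ C, ∀ y ∈ C.erase x, g x y ≤ 0 := by
    intro x hx y hy
    have hyC : y ∈ C := Finset.mem_of_mem_erase hy
    have hxy : x ≠ y := fun h => (Finset.ne_of_mem_erase hy) h.symm
    obtain ⟨lo, hi⟩ := hrange x hx y hyC hxy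
    have := h1 _ lo hi
    simp only [hg]; linarith
  have htle : ∀ x ∈ C, ∀ y ∈ C.erase x,
      (∑ z ∈ (C.erase x).erase y, F (inner ℝ x y) (inner ℝ x z) (inner ℝ y z)) ≤ 0 := by
    intro x hx y hy
    refine Finset.sum_nonpos fun z hz => ?_
    have hyC : y ∈ C := Finset.mem_of_mem_erase hy
    have hxy : x ≠ y := fun h => (Finset.ne_of_mem_erase hy) h.symm
    have hz1 : z ∈ C.erase x := Finset.mem_of_mem_erase hz
    have hzC : z ∈ C := Finset.mem_of_mem_erase hz1
    have hzy : z ≠ y := Finset.ne_of_mem_erase hz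
    have hzx : z ≠ x := Finset.ne_of_mem_erase hz1
    obtain ⟨lo1, hi1⟩ := hrange x hx y hyC hxy
    obtain ⟨lo2, hi2⟩ := hrange x hx z hzC hzx.symm
    obtain ⟨lo3, hi3⟩ := hrange y hyC z hzC hzy.symm
    exact h2 _ _ _ lo1 hi1 lo2 hi2 lo3 hi3 (gram3_nonneg x y z (hC x hx) (hC y hyC) (hC z hzC))
  -- Σ_x Σ_{y ≠ x} 1 = M (M - 1)
  have hones : (∑ x ∈ C, ∑ y ∈ C.erase x, (1 : ℝ)) = M * (M - 1) := by
    rw [Finset.sum_congr rfl fun x hx => by rw [Finset.sum_const, nsmul_eq_mul, mul_one, hcard1 x hx],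
      Finset.sum_const, nsmul_eq_mul, hM]
  -- the key identity: pairSum + tripleSum = M (A1 + F111) + Σ pairs (A + 3F) + Σ triples F
  set P : ℝ := ∑ x ∈ C, ∑ y ∈ C.erase x, g x y with hP
  set T : ℝ := ∑ x ∈ C, ∑ y ∈ C.erase x, ∑ z ∈ (C.erase x).erase y,
      F (inner ℝ x y) (inner ℝ x z) (inner ℝ y z) with hT
  have hPle : P ≤ 0 := Finset.sum_nonpos fun x hx => Finset.sum_nonpos fun y hy => hgle x hx y hy
  have hTle : T ≤ 0 := Finset.sum_nonpos fun x hx => Finset.sum_nonpos fun y hy => htle x hx y hy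
  have hPexp : P = (∑ x ∈ C, ∑ y ∈ C.erase x, (A (inner ℝ x y) + 3 * F (inner ℝ x y) (inner ℝ x y) 1))
      + M * (M - 1) := by
    rw [hP, ← hones, ← Finset.sum_add_distrib]
    refine Finset.sum_congr rfl fun x _ => ?_
    rw [← Finset.sum_add_distrib]
  have htot : pairSum C A + tripleSum C F = M * (A 1 + F 1 1 1) + (P - M * (M - 1)) + T := by
    rw [hpair, htriple, hPexp, hT]
    simp only [Finset.sum_add_distrib, Finset.mul_sum]
    ring
  -- with equality |C| = 1 + A1 + F111:  M (A1 + F111) = M (M - 1), so pairSum + tripleSum = P + T ≤ 0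
  have hval : A 1 + F 1 1 1 = M - 1 := by linarith [heq]
  have hsum0 : pairSum C A + tripleSum C F = P + T := by rw [htot, hval]; ring
  have hPA : pairSum C A = 0 := by linarith
  have hTF : tripleSum C F = 0 := by linarith
  have hP0 : P = 0 := by linarith
  refine ⟨hPA, hTF, ?_⟩
  intro x hx y hy hxy
  have hyE : y ∈ C.erase x := Finset.mem_erase.2 ⟨fun h => hxy h.symm, hy⟩
  have h := double_sum_eq_zero_terms C g hgle (by rw [← hP]; exact hP0) x hx y hyE
  simp only [hg] at h
  linarith

end Summit.Ventures.PackingBounds.SphericalCodes
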